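import Literature.NumberTheory.EllipticCurves.SelmerInftyTorsionFiniteProofs
import Literature.NumberTheory.EllipticCurves.H1UnramifiedFiniteProofs
import HarnessLib

/-!
# The `p`-torsion of `Sel_{p^∞}(E/F)` is finite, for `F = K̄^H` a finite extension in the subgroup model

For an elliptic curve `E = W` over a number field `K`, a prime `p` and an *open* normal subgroup
`H ≤ Γ_K` (so `F = K̄^H` is a finite Galois extension of `K`), the `p`-torsion of the Selmer group
`Sel_{p^∞}(E/F)` in the tree's subgroup model (`WeierstrassCurve.selmerGroupOver W p H`, file
`SubgroupSelmer`) is finite (`WeierstrassCurve.finite_torsionBy_selmerGroupOver`). This is the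
finiteness of the `p`-Selmer group of `E/F` (Silverman, *AEC*, Thm. X.4.2(b)) read at level `H`,
and it is the finiteness hypothesis of the tree's Lemma 4.14 of Dokchitser–Dokchitser
(`WeierstrassCurve.selmerCorank_eq_zpCorank_selmerGroupOverInvariants`, file
`SelmerRestrictionCorank`). The proof is Silverman's, run at level `H` with the tree's pieces:

* **(A) Kummer lift** `H¹(H, E[p]) ↠ H¹(H, E[p^∞])[p]` (the tree's
  `exists_torsionToPrimaryH1Sub_eq`, any subgroup `H`);
* **(B') Selmer classes are unramified at good places away from `p`**
  (`resOfLe_inf_eq_zero_of_mem_selmerGroupOver`, Cor. X.4.4 at level `H`): the lift restricts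
  to `0` on `I_𝔓 ∩ H` for every prime `𝔓` of `\bar ℤ_K` above a good place `v ∤ p` — the tree's
  `resOfLe_eq_zero_of_mem_selmerGroupOver` assumed `I_𝔓 ≤ H` (unramified towers); here the
  same argument is run on `I_𝔓 ∩ H`, the inertia group of `𝔓` in `H = Gal(K̄/F)`, so that the
  places of `K` ramified in `F` need not be excluded;
* **(C) Lemma X.4.3 at level `H`** (`finite_setOf_resOfLe_inertia_inf_eq_zero`): the classes of
  `H¹(H, M)` (`M` finite, continuous action) dying on all `I_𝔓 ∩ H`, `𝔓 ∣ v ∉ S`, form a finite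
  set — the cocycles inject into `Hom(U, M; S) × M^{H/U}` for `U = H ∩ ker(Γ_K → Aut M)`, and
  `Hom(U, M; S)` is finite for every open `U ≤ Γ_K` (Prop. VIII.1.6 in the `Hom` form,
  `finite_unramifiedHoms_holds`).

Everything here is proved; no named fact is introduced.

## References

* J. H. Silverman, *The Arithmetic of Elliptic Curves*, 2nd ed. (2009), X.§4: Lemma 4.3,
  Cor. 4.4, Thm. 4.2(b); Prop. VIII.1.6. [SilvermanAEC2009]
* T. Dokchitser, V. Dokchitser, Ann. of Math. 172 (2010), Lemma 4.14 (`X_p(E/F)` for `F/K`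
  finite Galois). [DokchitserDokchitserAnnals2010]
* R. Greenberg, LNM 1716 (1999), §2 (Selmer groups over algebraic extensions). [GreenbergLNM1716]
-/

open CategoryTheory Literature.NumberTheory.EllipticCurves Literature.NumberTheory.GaloisRepresentations

universe u

noncomputable section

/-! ## (C) Lemma X.4.3 at level `H` -/

namespace Literature.NumberTheory.EllipticCurves

open scoped Classical
open NumberField IsDedekindDomain TopRep ContRepresentation ContinuousCohomology

section LevelH

variable {K : Type u} [Field K]
variable {M : Type u} [AddCommGroup M] [DistribMulAction (Field.absoluteGaloisGroup K) M]
  [TopologicalSpace M] [DiscreteTopology M]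
variable (H : Subgroup (Field.absoluteGaloisGroup K))

/-- The kernel of the action inside `H`: `U_H = (ker (Γ_K → Aut M)) ∩ H` as a subgroup of `H`.
Silverman, *AEC*, X.§4, proof of Lemma 4.3. [folklore] -/
def fixingSubgroupIn : Subgroup H :=
  (fixingSubgroupOfModule K M).subgroupOf H

omit [TopologicalSpace M] [DiscreteTopology M] in
/-- Elements of `U_H` fix every element of `M`. [folklore] -/
theorem smul_eq_of_mem_fixingSubgroupIn {u : H} (hu : u ∈ fixingSubgroupIn (M := M) H) (m : M) :
    (u : Field.absoluteGaloisGroup K) • m = m :=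
  smul_eq_of_mem_fixingSubgroupOfModule (Subgroup.mem_subgroupOf.mp hu) m

/-- `U_H` is open in `H` for `M` finite with continuous action. [folklore] -/
theorem isOpen_fixingSubgroupIn [Finite M] [ContinuousSMul (Field.absoluteGaloisGroup K) M] :
    IsOpen (fixingSubgroupIn (M := M) H : Set H) :=
  (isOpen_fixingSubgroupOfModule (K := K) (M := M)).preimage continuous_subtype_val

/-- The restriction data of a continuous crossed homomorphism `c : H → M`: its values on
`U = H ∩ ker(Γ_K → Aut M)` (as a function on the subgroup `H ⊓ ker` of `Γ_K`) and on the chosen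
coset representatives of `H / U_H`. [folklore] -/
def resDataSub (c : contOneCocycles (discreteTopRep H M)) :
    (↥(H ⊓ fixingSubgroupOfModule K M) → M) × (H ⧸ fixingSubgroupIn (M := M) H → M) :=
  (fun u ↦ c.1 ⟨u.1, u.2.1⟩, fun q ↦ c.1 q.out)

/-- A continuous crossed homomorphism `c : H → M` is determined by its restriction data
(`c (g u) = c g + g • c u`). Serre, *Galois Cohomology*, I.§5.8. [folklore] -/
theorem resDataSub_injective :
    Function.Injective fun c : contOneCocycles (discreteTopRep H M) ↦ resDataSub H c := by
  intro c c' hcc'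
  simp only [resDataSub, Prod.mk.injEq] at hcc'
  obtain ⟨hU, hQ⟩ := hcc'
  apply Subtype.ext
  ext g
  set U := fixingSubgroupIn (M := M) H
  obtain ⟨u, hu⟩ := QuotientGroup.mk_out_eq_mul U g
  have hg : g = (QuotientGroup.mk g : H ⧸ U).out * ((u⁻¹ : U) : H) := by
    rw [hu, Subgroup.coe_inv, mul_inv_cancel_right]
  have humem : (((u⁻¹ : U) : H) : Field.absoluteGaloisGroup K) ∈ H ⊓ fixingSubgroupOfModule K M :=
    ⟨((u⁻¹ : U) : H).2, Subgroup.mem_subgroupOf.mp (u⁻¹).2⟩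
  have hcu : c.1 ((u⁻¹ : U) : H) = c'.1 ((u⁻¹ : U) : H) :=
    congr_fun hU ⟨(((u⁻¹ : U) : H) : Field.absoluteGaloisGroup K), humem⟩
  rw [hg, c.2, c'.2, congr_fun hQ (QuotientGroup.mk g), hcu]

/-- **Cocycle criterion.** The restriction of `[c] ∈ H¹(H, M)` to a subgroup `H₁ ≤ H` vanishes
iff `c|_{H₁}` is principal. Serre, *Galois Cohomology*, I.§5.1. [folklore] -/
theorem resOfLe_oneCocycleClass_eq_zero_iff {H₁ : Subgroup (Field.absoluteGaloisGroup K)}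
    (h : H₁ ≤ H) (c : contOneCocycles (discreteTopRep H M)) :
    resOfLe M h (oneCocycleClass (discreteTopRep H M) c) = 0 ↔
      ∃ a : M, ∀ σ : H₁, c.1 (subgroupInclusion h σ) =
        (σ : Field.absoluteGaloisGroup K) • a - a := by
  rw [resOfLe, resH1Hom]
  change ContinuousCohomology.map _ _ 1 (oneCocycleClass (discreteTopRep H M) c) = 0 ↔ _
  rw [map_oneCocycleClass, oneCocycleClass_eq_zero_iff]
  rfl

/-- If `[c]` dies on every `I_𝔓 ∩ H`, `𝔓 ∣ v ∉ S`, then `c|_{H ∩ ker}` lies in `Hom(H ∩ ker, M; S)`: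
a continuous homomorphism (trivial action) vanishing on `I_𝔓 ∩ (H ∩ ker)` (there
`c σ = σ • a - a = 0`). Silverman, *AEC*, X.§4, proof of Lemma 4.3. [folklore] -/
theorem resDataSub_fst_mem_unramifiedHoms {S : Set (HeightOneSpectrum (𝓞 K))}
    (c : contOneCocycles (discreteTopRep H M))
    (hc : ∀ v : HeightOneSpectrum (𝓞 K), v ∉ S → ∀ 𝔓 ∈ v.primesAbove,
      resOfLe M (inf_le_right : 𝔓.inertia (Field.absoluteGaloisGroup K) ⊓ H ≤ H)
        (oneCocycleClass (discreteTopRep H M) c) = 0) :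
    (resDataSub H c).1 ∈ unramifiedHoms (H ⊓ fixingSubgroupOfModule K M) M S := by
  refine ⟨?_, fun σ τ ↦ ?_, fun v hv 𝔓 h𝔓 σ hσ ↦ ?_⟩
  · exact c.1.continuous.comp (Continuous.subtype_mk continuous_subtype_val _)
  · have hmem : σ.1 * τ.1 ∈ H := H.mul_mem σ.2.1 τ.2.1
    change c.1 ⟨σ.1 * τ.1, hmem⟩ = c.1 ⟨σ.1, σ.2.1⟩ + c.1 ⟨τ.1, τ.2.1⟩
    have e : (⟨σ.1 * τ.1, hmem⟩ : H) = ⟨σ.1, σ.2.1⟩ * ⟨τ.1, τ.2.1⟩ := rfl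
    have hfix : ((⟨σ.1, σ.2.1⟩ : H) : Field.absoluteGaloisGroup K) • c.1 ⟨τ.1, τ.2.1⟩ =
        c.1 ⟨τ.1, τ.2.1⟩ := smul_eq_of_mem_fixingSubgroupOfModule σ.2.2 _
    rw [e, c.2, discreteTopRep_ρ_apply, Subgroup.smul_def, hfix]
  · obtain ⟨a, ha⟩ := (resOfLe_oneCocycleClass_eq_zero_iff H inf_le_right c).mp (hc v hv 𝔓 h𝔓)
    have hmem : (σ : Field.absoluteGaloisGroup K) ∈ 𝔓.inertia (Field.absoluteGaloisGroup K) ⊓ H :=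
      ⟨hσ, σ.2.1⟩
    have := ha ⟨σ, hmem⟩
    change c.1 ⟨σ.1, σ.2.1⟩ = 0
    have e : (subgroupInclusion (inf_le_right : 𝔓.inertia (Field.absoluteGaloisGroup K) ⊓ H ≤ H)
        ⟨σ, hmem⟩ : H) = ⟨σ.1, σ.2.1⟩ := rfl
    rw [← e, this, smul_eq_of_mem_fixingSubgroupOfModule σ.2.2, sub_self]

/-- **Lemma X.4.3 at level `H`, on cocycles.** For `H ≤ Γ_K` open, `M` finite with continuous
action and `S` finite, the continuous crossed homomorphisms `H → M` whose class dies on every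
`I_𝔓 ∩ H` (`𝔓 ∣ v ∉ S`) form a finite set: they inject into `Hom(H ∩ ker, M; S) × M^{H/U_H}`
(`resDataSub_injective`), finite by Prop. VIII.1.6 (`finite_unramifiedHoms_holds`) and the
finiteness of `H / U_H` (`U_H` open in the compact `H`). Silverman, *AEC*, X.§4, Lemma 4.3.
[cite: SilvermanAEC2009, Lemma X.4.3] -/
theorem finite_setOf_cocycle_resOfLe_inertia_inf_eq_zero [NumberField K] [Finite M]
    [ContinuousSMul (Field.absoluteGaloisGroup K) M] (hH : IsOpen (H : Set (Field.absoluteGaloisGroup K)))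
    {S : Set (HeightOneSpectrum (𝓞 K))} (hS : S.Finite) :
    {c : contOneCocycles (discreteTopRep H M) |
      ∀ v : HeightOneSpectrum (𝓞 K), v ∉ S → ∀ 𝔓 ∈ v.primesAbove,
        resOfLe M (inf_le_right : 𝔓.inertia (Field.absoluteGaloisGroup K) ⊓ H ≤ H)
          (oneCocycleClass (discreteTopRep H M) c) = 0}.Finite := by
  haveI : CompactSpace (Field.absoluteGaloisGroup K) := compactSpace_absoluteGaloisGroup K
  haveI : CompactSpace H :=
    isCompact_iff_compactSpace.mp (Subgroup.isClosed_of_isOpen H hH).isCompact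
  set U := fixingSubgroupIn (M := M) H
  haveI : Finite (H ⧸ U) := Subgroup.quotient_finite_of_isOpen U (isOpen_fixingSubgroupIn H)
  have hU₀ : IsOpen ((H ⊓ fixingSubgroupOfModule K M : Subgroup (Field.absoluteGaloisGroup K)) :
      Set (Field.absoluteGaloisGroup K)) := by
    rw [Subgroup.coe_inf]
    exact hH.inter isOpen_fixingSubgroupOfModule
  have hfin : ((unramifiedHoms (H ⊓ fixingSubgroupOfModule K M) M S) ×ˢ
      (Set.univ : Set (H ⧸ U → M))).Finite :=
    (finite_unramifiedHoms_holds K (H ⊓ fixingSubgroupOfModule K M) hU₀ M hS).prod Set.finite_univ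
  refine Set.Finite.of_finite_image
    (f := fun c : contOneCocycles (discreteTopRep H M) ↦ resDataSub H c) (hfin.subset ?_)
    (resDataSub_injective H).injOn
  rintro _ ⟨c, hc, rfl⟩
  exact ⟨resDataSub_fst_mem_unramifiedHoms H c hc, Set.mem_univ _⟩

/-- **Lemma X.4.3 at level `H`, on classes**: the classes of `H¹(H, M)` dying on every `I_𝔓 ∩ H`
(`𝔓 ∣ v ∉ S`) form a finite set. [cite: SilvermanAEC2009, Lemma X.4.3] -/
theorem finite_setOf_resOfLe_inertia_inf_eq_zero [NumberField K] [Finite M]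
    [ContinuousSMul (Field.absoluteGaloisGroup K) M] (hH : IsOpen (H : Set (Field.absoluteGaloisGroup K)))
    {S : Set (HeightOneSpectrum (𝓞 K))} (hS : S.Finite) :
    {y : subgroupH1 H M |
      ∀ v : HeightOneSpectrum (𝓞 K), v ∉ S → ∀ 𝔓 ∈ v.primesAbove,
        resOfLe M (inf_le_right : 𝔓.inertia (Field.absoluteGaloisGroup K) ⊓ H ≤ H) y = 0}.Finite := by
  refine ((finite_setOf_cocycle_resOfLe_inertia_inf_eq_zero H hH hS).image
    (oneCocycleClass (discreteTopRep H M))).subset ?_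
  intro y hy
  obtain ⟨c, rfl⟩ := oneCocycleClass_surjective _ y
  exact ⟨c, hy, rfl⟩

end LevelH

end Literature.NumberTheory.EllipticCurves

/-! ## (B') Selmer classes over `K̄^H` vanish on `I_𝔓 ∩ H` at good places away from `p` -/

namespace WeierstrassCurve

open scoped Classical AddSubgroup Pointwise
open NumberField IsDedekindDomain

variable {K : Type u} [Field K] {W : WeierstrassCurve K} {p : ℕ} [Fact p.Prime]
variable {H : Subgroup (Field.absoluteGaloisGroup K)} [NumberField K] [H.Normal]

omit [Fact p.Prime] in
/-- **(B') Selmer classes over `K̄^H` are unramified outside the bad places and `p`** (Silverman,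
*AEC*, Cor. X.4.4, at the level of a normal subgroup `H ≤ Γ_K`, for the inertia groups
`I_𝔓 ∩ H` *in* `H`): if the image in `H¹(H, E[p^∞])` of `y ∈ H¹(H, E[p])` lies in
`Sel_{p^∞}(E/K̄^H) = selmerGroupOver p H`, then `y` restricts to `0` in `H¹(I_𝔓 ∩ H, E[p])` for
every prime `𝔓` of `\bar ℤ_K` above a place `v` of good reduction with `v ∤ p`. The argument is
the tree's `resOfLe_eq_zero_of_mem_selmerGroupOver` verbatim, evaluated only at `τ ∈ I_𝔓 ∩ H`
(there `I_𝔓 ≤ H` was assumed): transport to the prime cut out by the chosen embedding, the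
Selmer condition for `conj_{g⁻¹}`, local–global inertia, and the reduction step AEC VIII.1.4
applied to `p (σ' P - P) = 0`. [cite: SilvermanAEC2009, Cor. X.4.4 (proof of Thm. X.4.2(b))] -/
theorem resOfLe_inf_eq_zero_of_mem_selmerGroupOver [W.IsElliptic]
    {y : Literature.NumberTheory.EllipticCurves.subgroupH1 H (geomTorsion W (p : ℤ))}
    (hy : W.torsionToPrimaryH1Sub p H y ∈ W.selmerGroupOver p H)
    {v : HeightOneSpectrum (𝓞 K)} (hv : v ∉ W.badPlaces (𝓞 K)) (hpv : (p : 𝓞 K) ∉ v.asIdeal)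
    {𝔓 : Ideal (absIntegers (𝓞 K) K)} (h𝔓 : 𝔓 ∈ v.primesAbove) :
    Literature.NumberTheory.EllipticCurves.resOfLe (geomTorsion W (p : ℤ))
      (inf_le_right : 𝔓.inertia (Field.absoluteGaloisGroup K) ⊓ H ≤ H) y = 0 := by
  obtain ⟨φ, rfl⟩ := oneCocycleClass_surjective _ y
  -- base prime `𝔓₀` from the chosen embedding and a local prime `𝔐`, and `g` with `g • 𝔓₀ = 𝔓`
  obtain ⟨𝔐, h𝔐⟩ := v.localPrimesAbove_nonempty
  set ι₀ := closureEmb (K := K) (v.adicCompletion K) with hι₀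
  obtain ⟨g, hg⟩ := HeightOneSpectrum.exists_smul_eq_of_mem_primesAbove_holds
    (HeightOneSpectrum.primeBelow_mem_primesAbove (ι := ι₀) h𝔐) h𝔓
  -- the Selmer condition at `v`, conjugated by `g⁻¹`
  have hsel := ((W.mem_selmerGroupOver_iff p H _).mp hy).1 v g⁻¹
  rw [torsionToPrimaryH1Sub_oneCocycleClass] at hsel
  have hc : ∀ (x : H) (m : geomPrimaryTorsion W p),
      DistribSMul.toAddMonoidHom _ g⁻¹ (subgroupConj H g⁻¹ x • m) =
        x • DistribSMul.toAddMonoidHom _ g⁻¹ m := fun x m ↦ by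
    simp only [DistribSMul.toAddMonoidHom_apply, Subgroup.smul_def, subgroupConj_apply_coe,
      smul_smul, mul_assoc, mul_inv_cancel_left]
  set ψ := contOneCocycles.push (AddSubgroup.inclusion (geomTorsion_le_geomPrimaryTorsion W p))
    (fun _ _ ↦ rfl) φ with hψ
  have hconj : W.conjH1 p H g⁻¹ (oneCocycleClass _ ψ) = oneCocycleClass _
      (contOneCocycles.pullback (subgroupConj H g⁻¹)
        (resHomOfEquivariant (subgroupConj H g⁻¹) (DistribSMul.toAddMonoidHom _ g⁻¹) hc) ψ) :=
    map_oneCocycleClass _ _ _ ψ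
  rw [hconj] at hsel
  obtain ⟨P, hP⟩ := (oneCocycleClass_mem_resKer_iff _ _ _ _).mp hsel
  -- `φ` vanishes on `I_𝔓 ∩ H`
  have hvan : ∀ τ : Field.absoluteGaloisGroup K, τ ∈ 𝔓.inertia (Field.absoluteGaloisGroup K) →
      ∀ hτH : τ ∈ H, φ.1 ⟨τ, hτH⟩ = 0 := by
    intro τ hτ hτH
    have hσ₀ : g⁻¹ * τ * g ∈ (v.primeBelow ι₀ 𝔐).inertia (Field.absoluteGaloisGroup K) := by
      rw [← mem_inertia_smul_iff, hg]; exact hτ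
    obtain ⟨σ', hσ'I, hσ'⟩ :=
      HeightOneSpectrum.exists_mem_inertia_apply_eq_holds v ι₀ h𝔐 hσ₀
    have hres : resGalOfEmb ι₀ σ' = g⁻¹ * τ * g := resGalOfEmb_eq_of_apply_eq ι₀ hσ'
    have hσ₀H : g⁻¹ * τ * g ∈ H := by
      have := Subgroup.Normal.conj_mem inferInstance τ hτH g⁻¹
      simpa using this
    have hσ'mem : σ' ∈ localSubgroupOfEmb H ι₀ := by
      rw [mem_localSubgroupOfEmb_iff, hres]; exact hσ₀H
    have key := hP ⟨σ', hσ'mem⟩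
    have e0 : subgroupConj H g⁻¹ (resGalSubgroupOfEmb H ι₀ ⟨σ', hσ'mem⟩) = ⟨τ, hτH⟩ :=
      Subtype.ext (by rw [subgroupConj_apply_coe, resGalSubgroupOfEmb_apply_coe, hres]; group)
    have e1 : (contOneCocycles.pullback (subgroupConj H g⁻¹)
        (resHomOfEquivariant (subgroupConj H g⁻¹) (DistribSMul.toAddMonoidHom _ g⁻¹) hc) ψ).1
          (resGalSubgroupOfEmb H ι₀ ⟨σ', hσ'mem⟩) =
        g⁻¹ • AddSubgroup.inclusion (geomTorsion_le_geomPrimaryTorsion W p) (φ.1 ⟨τ, hτH⟩) := by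
      rw [contOneCocycles.pullback_apply, e0]
      rfl
    rw [e1, Subgroup.mk_smul] at key
    have hpφ : p • φ.1 ⟨τ, hτH⟩ = 0 :=
      Subtype.ext (by
        rw [AddSubgroupClass.coe_nsmul, ZeroMemClass.coe_zero]
        exact AddSubgroup.torsionBy.nsmul_iff.mp (φ.1 ⟨τ, hτH⟩).2)
    have hpv' : (((p : ℤ) : 𝓞 K)) ∉ v.asIdeal := by rwa [Int.cast_natCast]
    have hfix : σ' • P = P := by
      refine smul_localPoints_eq_of_mem_inertia_holds W v hv hpv' h𝔐 hσ'I (P := P) ?_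
      rw [natCast_zsmul, ← key, ← map_nsmul, smul_comm p g⁻¹, ← map_nsmul, hpφ, map_zero,
        smul_zero, map_zero]
    rw [hfix, sub_self] at key
    have h1 : ((g⁻¹ • AddSubgroup.inclusion (geomTorsion_le_geomPrimaryTorsion W p) (φ.1 ⟨τ, hτH⟩) :
        geomPrimaryTorsion W p) : geomPoints W) = 0 :=
      (injective_iff_map_eq_zero _).mp (pointsMapOfEmb_injective W ι₀) _ key
    have h2 : AddSubgroup.inclusion (geomTorsion_le_geomPrimaryTorsion W p) (φ.1 ⟨τ, hτH⟩) = 0 := by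
      have : g⁻¹ • AddSubgroup.inclusion (geomTorsion_le_geomPrimaryTorsion W p) (φ.1 ⟨τ, hτH⟩) = 0 :=
        Subtype.ext h1
      rwa [smul_eq_zero_iff_eq] at this
    exact (injective_iff_map_eq_zero _).mp (AddSubgroup.inclusion_injective _) _ h2
  -- conclude: the restriction to `I_𝔓 ∩ H` is the class of the zero cocycle
  have hmap : Literature.NumberTheory.EllipticCurves.resOfLe (geomTorsion W (p : ℤ))
      (inf_le_right : 𝔓.inertia (Field.absoluteGaloisGroup K) ⊓ H ≤ H) (oneCocycleClass _ φ) =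
      oneCocycleClass _ (contOneCocycles.pullback (subgroupInclusion inf_le_right)
        (resHomOfEquivariant (subgroupInclusion
          (inf_le_right : 𝔓.inertia (Field.absoluteGaloisGroup K) ⊓ H ≤ H))
          (AddMonoidHom.id (geomTorsion W (p : ℤ))) (fun _ _ ↦ rfl)) φ) :=
    map_oneCocycleClass _ _ _ φ
  rw [hmap, oneCocycleClass_eq_zero_iff]
  refine ⟨0, fun τ ↦ ?_⟩
  rw [contOneCocycles.pullback_apply, map_zero, sub_zero]
  exact hvan τ τ.2.1 τ.2.2

/-! ## Assembly: `Sel_{p^∞}(E/K̄^H)[p]` is finite -/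

variable (W p H) in
/-- **The `p`-torsion of `Sel_{p^∞}(E/F)` is finite**, `F = K̄^H` for an open normal subgroup
`H ≤ Γ_K` of a number field `K` and an elliptic curve `E/K` (Silverman, *AEC*, Thm. X.4.2(b) at
level `H`): every `s ∈ Sel_{p^∞}(E/F)[p]` lifts to `H¹(H, E[p])` (A), the lift dies on every
`I_𝔓 ∩ H` above the good places `v ∤ p` (B'), and such classes form a finite set (Lemma X.4.3 at
level `H`, (C)); `s` is recovered from its lift, so `Sel_{p^∞}(E/F)[p]` injects into a finite set.
[cite: SilvermanAEC2009, Thm. X.4.2(b)] -/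
theorem finite_torsionBy_selmerGroupOver [W.IsElliptic]
    (hH : IsOpen (H : Set (Field.absoluteGaloisGroup K))) :
    Finite (W.selmerGroupOver p H)[(p : ℤ)] := by
  classical
  have hp := (Fact.out : p.Prime)
  -- the finite set of places
  let S : Set (HeightOneSpectrum (𝓞 K)) := W.badPlaces (𝓞 K) ∪ {v | ((p : ℤ) : 𝓞 K) ∈ v.asIdeal}
  have hbad : (W.badPlaces (𝓞 K)).Finite := W.finite_badPlaces_holds (𝓞 K)
  have hS : S.Finite := hbad.union (finite_setOf_intCast_mem_asIdeal (by exact_mod_cast hp.ne_zero))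
  -- (C) the unramified classes of `H¹(H, E[p])` are finite
  haveI : Finite (geomTorsion W (p : ℤ)) :=
    finite_torsionPoints_holds W (AlgebraicClosure K) (by exact_mod_cast hp.ne_zero)
  haveI : ContinuousSMul (Field.absoluteGaloisGroup K) (geomTorsion W (p : ℤ)) :=
    continuousSMul_geomTorsion W (isOpen_stabilizer_point_holds W) _
  have hC := finite_setOf_resOfLe_inertia_inf_eq_zero (M := geomTorsion W (p : ℤ)) H hH hS
  haveI := hC.to_subtype
  -- the lift of a `p`-torsion Selmer class and its unramifiedness
  have hlift : ∀ s : (W.selmerGroupOver p H)[(p : ℤ)],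
      ∃ y : Literature.NumberTheory.EllipticCurves.subgroupH1 H (geomTorsion W (p : ℤ)),
        W.torsionToPrimaryH1Sub p H y = ((s : W.selmerGroupOver p H) : W.subgroupH1 p H) := fun s ↦ by
    have hps : p • ((s : W.selmerGroupOver p H) : W.subgroupH1 p H) = 0 := by
      have h := congrArg (fun z : W.selmerGroupOver p H ↦ (z : W.subgroupH1 p H))
        (AddSubgroup.torsionBy.nsmul_iff.mp s.2)
      simpa only [AddSubmonoidClass.coe_nsmul, ZeroMemClass.coe_zero] using h
    exact W.exists_torsionToPrimaryH1Sub_eq p (H := H) W.zsmul_geomPoints_surjective_holds hps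
  choose lift hlift using hlift
  have hunr : ∀ s : (W.selmerGroupOver p H)[(p : ℤ)], lift s ∈
      {y : Literature.NumberTheory.EllipticCurves.subgroupH1 H (geomTorsion W (p : ℤ)) |
        ∀ v : HeightOneSpectrum (𝓞 K), v ∉ S → ∀ 𝔓 ∈ v.primesAbove,
          Literature.NumberTheory.EllipticCurves.resOfLe (geomTorsion W (p : ℤ))
            (inf_le_right : 𝔓.inertia (Field.absoluteGaloisGroup K) ⊓ H ≤ H) y = 0} := by
    intro s v hv 𝔓 h𝔓
    have hv' : v ∉ W.badPlaces (𝓞 K) := fun h ↦ hv (Or.inl h)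
    have hpv : (p : 𝓞 K) ∉ v.asIdeal := fun h ↦ hv (Or.inr (by simpa using h))
    have hy : W.torsionToPrimaryH1Sub p H (lift s) ∈ W.selmerGroupOver p H := by
      rw [hlift s]; exact (s : W.selmerGroupOver p H).2
    exact resOfLe_inf_eq_zero_of_mem_selmerGroupOver hy hv' hpv h𝔓
  -- `s ↦ lift s` is injective into the finite set
  refine Finite.of_injective (fun s ↦ (⟨lift s, hunr s⟩ : {y // y ∈ {y :
      Literature.NumberTheory.EllipticCurves.subgroupH1 H (geomTorsion W (p : ℤ)) |
        ∀ v : HeightOneSpectrum (𝓞 K), v ∉ S → ∀ 𝔓 ∈ v.primesAbove,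
          Literature.NumberTheory.EllipticCurves.resOfLe (geomTorsion W (p : ℤ))
            (inf_le_right : 𝔓.inertia (Field.absoluteGaloisGroup K) ⊓ H ≤ H) y = 0}})) ?_
  intro s t hst
  have h := congrArg (fun z : {y // y ∈ {y :
      Literature.NumberTheory.EllipticCurves.subgroupH1 H (geomTorsion W (p : ℤ)) |
        ∀ v : HeightOneSpectrum (𝓞 K), v ∉ S → ∀ 𝔓 ∈ v.primesAbove,
          Literature.NumberTheory.EllipticCurves.resOfLe (geomTorsion W (p : ℤ))
            (inf_le_right : 𝔓.inertia (Field.absoluteGaloisGroup K) ⊓ H ≤ H) y = 0}} ↦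
      W.torsionToPrimaryH1Sub p H z.1) hst
  simp only [hlift] at h
  exact Subtype.ext (Subtype.ext h)

end WeierstrassCurve
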